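import Mathlib
import HarnessLib
import Summits.ValiantsHypothesis.ValiantsHypothesis.Theses.MonotoneRestoration
import Literature.Computability.AlgebraicComplexity.ArithCircuit
import Literature.Computability.AlgebraicComplexity.ArithCircuitProofs
import Literature.Computability.AlgebraicComplexity.MonotoneStructure
import Literature.Computability.AlgebraicComplexity.PermanentIrreducible
import Literature.ModelTheory.FiniteModelTheory.CkEquiv
import Summits.ValiantsHypothesis.ValiantsHypothesis.Theorems.MonotoneRestorationMonotoneRestorationQPCosetCount
import Summits.ValiantsHypothesis.ValiantsHypothesis.Theorems.MonotoneRestorationMonotoneRestorationQPSymmetricLB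
import Summits.ValiantsHypothesis.ValiantsHypothesis.Theorems.MonotoneRestorationMonotoneRestorationQPSupportSymmetrisation
import Summits.ValiantsHypothesis.ValiantsHypothesis.Theorems.MonotoneRestorationMonotoneRestorationQPSparseRegime
import Summits.ValiantsHypothesis.ValiantsHypothesis.Theorems.MonotoneRestorationMonotoneRestorationQPBeta
import Literature.Computability.AlgebraicComplexity.SymmetricArithCircuit
import Literature.Computability.AlgebraicComplexity.DawarWilsenach2025Proofs
import Literature.GroupTheory.PermutationGroups.SmallIndexSubgroups
import Summits.ValiantsHypothesis.ValiantsHypothesis.Theorems.MonotoneRestorationQP.Negative.LoadBearing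
import Summits.ValiantsHypothesis.ValiantsHypothesis.Theorems.MonotoneRestorationMonotoneRestorationQPPermSupportCount
import Literature.Computability.AlgebraicComplexity.HomogeneousComponentsComplexity

/-! TTRL-lite variant V20228 of stmt-ValiantsHypothesis-15886 -/

-- `ValiantsHypothesis.ValiantsHypothesis`: the D-0017 layout repeats the problem name in the path.
set_option linter.dupNamespace false

namespace Summit.ValiantsHypothesis.ValiantsHypothesis.Theorems

open Summit.ValiantsHypothesis.ValiantsHypothesis.Theses.MonotoneRestoration
open Literature.Computability.AlgebraicComplexity

/-- TTRL-lite variant V20228 of `stub_esymmRowSums_complexity` (stmt-ValiantsHypothesis-15886):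
**Strassen homogenisation is monotone.** Over the semiring `ℝ≥0` (no subtraction, so no
interpolation), the degree-`d` homogeneous component of `f` costs at most
`4 (d + 1)² (L(f) + 1)` fan-in-two gates: homogenise a size-optimal circuit gate by gate
(BCS 1997, Lemma (21.25), carried out over an arbitrary commutative semiring in the tree as
`complexity_homogeneousComponent_le_sq_mul : L(f^{(d)}) ≤ (d + 2)² · L(f)`), and
`(d + 2)² ≤ 4 (d + 1)²`. [cite: BurgisserClausenShokrollahi1997, Lemma (21.25)] -/
theorem stub_esymmRowSums_complexity_var20228 :
    ∀ (σ : Type) (f : MvPolynomial σ NNReal) (d : ℕ),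
      complexity (MvPolynomial.homogeneousComponent d f) ≤ 4 * (d + 1) ^ 2 * (complexity f + 1) := by
  intro σ f d
  have h2 : (d + 2) ^ 2 ≤ 4 * (d + 1) ^ 2 :=
    calc (d + 2) ^ 2 ≤ (2 * (d + 1)) ^ 2 := Nat.pow_le_pow_left (by omega) 2
      _ = 4 * (d + 1) ^ 2 := by ring
  calc complexity (MvPolynomial.homogeneousComponent d f)
      ≤ (d + 2) ^ 2 * complexity f := complexity_homogeneousComponent_le_sq_mul f d
    _ ≤ 4 * (d + 1) ^ 2 * complexity f := Nat.mul_le_mul_right _ h2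
    _ ≤ 4 * (d + 1) ^ 2 * (complexity f + 1) := Nat.mul_le_mul_left _ (Nat.le_succ _)

end Summit.ValiantsHypothesis.ValiantsHypothesis.Theorems
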